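import Summits.ValiantsHypothesis.ValiantsHypothesis.Theorems.BarrierLeverDescentCertificateSuffices
import Summits.ValiantsHypothesis.ValiantsHypothesis.Theorems.BarrierLeverTropicalDetCertificateSuffices

/-!
# Route BarrierLever — item `TransversalMinorLayoutsNonsingular` (TT, stmt-ValiantsHypothesis-19152)
# holds on every layout that carries a LABEL-MIN (descent) certificate

Helper file (`--supports stmt-ValiantsHypothesis-19152`; cell valiant-natproofs, rung V4, 𝒟-side;
prover seat val-np-p1). Closes NO item. One arrow assembling two tree theorems: item 19573
(`…Descent.descentCertificateSuffices` / its outer lemma `…Descent.sum_inf_lt`: a label-min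
certificate `(e, π₀)` for the layout `(u, w)` yields a tropical-determinant certificate `(D, π₀)`,
`D = Descent.dwt e B`) and item 19315 (`…TropicalDet.tropicalDetCertificateSuffices`: a
tropical-determinant certificate forces the transversal layout minor to be nonzero for some `H`).
Hence the conclusion of TT,
`∃ H : Matrix (Fin (h+h)) (Fin (h+h)) ℂ, det (det H[ρ_{u i}, κ_{w j}])_{i,j} ≠ 0`, holds for every
layout with a label-min certificate
(`transversalMinor_nonsingular_of_descentCertificate`); no injectivity hypothesis is needed.
By the planner census (memo `UTD-memo-g9.md` §2, kit j251909 + j252035) every one of the 273 test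
layouts (`h ≤ 8`, exchange distance `d ≤ 64`) carries such a certificate, so each of them is a TT
instance once its certificate is checked.

WHAT THIS IS NOT: TT (item 19152) asks this for ALL injective layouts and stays OPEN — label-min
certificates do NOT exist for every layout (`…DescentFail.descentCertificatesFail`, the antipodal
star, item 19579); nothing on TNS / item 19717 layout-wise, on crux stmt-ValiantsHypothesis-14610,
or on `VP` versus `VNP`.
-/

-- layout Summits/ValiantsHypothesis/ValiantsHypothesis forces the duplicated namespace component
set_option linter.dupNamespace false

namespace Summit.ValiantsHypothesis.ValiantsHypothesis.Theorems.BarrierLever.Descent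

open Finset

/-- **TT on layouts with a label-min certificate.** If a valuation `e` of literal pairs and an
assignment `π₀` fixing the common points of the layout `(u, w)` make the label-min cost of `π₀`
strictly smaller than that of every other assignment fixing the common points (the hypothesis of
item 19573, with `Descent.labels`), then some `H : Matrix (Fin (h+h)) (Fin (h+h)) ℂ` makes the
transversal layout matrix `(det H[ρ_{u i}, κ_{w j}])_{i,j}` nonsingular (items 19573 + 19315). -/
theorem transversalMinor_nonsingular_of_descentCertificate (h r : ℕ) (u w : Fin r → Finset (Fin h))
    (hcert : ∃ (e : Fin (h + h) → Fin (h + h) → ℕ) (π₀ : Equiv.Perm (Fin r)),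
      (∀ j, (∃ i, u i = w j) → u (π₀ j) = w j) ∧
      ∀ σ : Equiv.Perm (Fin r), (∀ j, (∃ i, u i = w j) → u (σ j) = w j) → σ ≠ π₀ →
        ∑ j ∈ univ.filter (fun j => ∀ i, u i ≠ w j), sInf (labels e (u (π₀ j)) (w j)) <
          ∑ j ∈ univ.filter (fun j => ∀ i, u i ≠ w j), sInf (labels e (u (σ j)) (w j))) :
    ∃ H : Matrix (Fin (h + h)) (Fin (h + h)) ℂ, (Matrix.of fun i j : Fin r =>
      (H.submatrix (fun a : Fin h => if a ∈ u i then Fin.castAdd h a else Fin.natAdd h a)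
        (fun c : Fin h => if c ∈ w j then Fin.natAdd h c else Fin.castAdd h c)).det).det ≠ 0 := by
  obtain ⟨e, π₀, hπ₀, hopt⟩ := hcert
  have hE : ∀ p q, e p q ≤ ∑ p', ∑ q', e p' q' := fun p q =>
    le_trans (single_le_sum (f := fun q' => e p q') (fun _ _ => Nat.zero_le _) (mem_univ q))
      (single_le_sum (f := fun p' => ∑ q', e p' q') (fun _ _ => Nat.zero_le _) (mem_univ p))
  exact TropicalDet.tropicalDetCertificateSuffices h r u w
    (dwt e (r * (∑ p', ∑ q', e p' q') + (∑ p', ∑ q', e p' q') + 1)) _ (fun _ _ => rfl) π₀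
    (fun σ hσ => sum_inf_lt u w e _ hE π₀ hπ₀ hopt σ hσ)

end Summit.ValiantsHypothesis.ValiantsHypothesis.Theorems.BarrierLever.Descent
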